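import Summits.Ventures.PercRepro.ProfileUnicyclicLym

/-!
# PercRepro — THE UNICYCLIC LYM PIECE `(c)` DECOMPOSES OVER THE CIRCUITS: THE CIRCUIT-MARKED REFINEMENT OF
THEOREM A (p10, gen 10; `proofs/P10-AVFULL.md` §19)

On `#E = ρ + q + 1` the open piece `(c)` of the top-but-one level (ProfileUnicyclicLym) is
`ρ·U_{q+1} ≤ (q+1)·U_{q+2}`, `U_k = #{X : #X = k, X unicyclic, E ∖ X independent}`.  A unicyclic set `X` has a
unique circuit `C_X = {x ∈ X : X ∖ x independent}` (`circ`), so `U_k = Σ_D U^D_k` with `U^D_k` the unicyclic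
`k`-sets with independent complement and circuit `D` (`uniIndepSetsCirc`, `card_uniIndepSets_eq_sum`).  The
per-circuit statement

  `(E_D)  (n − k)·U^D_k ≤ k·U^D_{k+1}   for every circuit D and every k with 2k + 1 ≤ n`

(the density `U^D_k / C(n−1, k−1)` is nondecreasing up to the middle) is the CIRCUIT-MARKED REFINEMENT OF
THEOREM A: for `D = {e}` a loop it is Theorem A (Brändén–Huh) for `M ∖ e` verbatim (`U^{{e}}_k = P_{k−1}(M ∖ e)`);
for `D = {e, e'}` a parallel pair it is the `e`-MARKED Theorem A for `T = M ∖ e'`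
(`U^D_k = #{X ∋ e : X, E ∖ X independent in T, #X = k − 1}`), an inequality that is an IDENTITY on every
uniform matroid.  DATA (P10-AVFULL.md §19): `(E_D)` holds for every circuit of every matroid on `≤ 9` elements
(0 / 14,160,824 instances at `n = 9`); it is NOT proved and nothing here asserts it — `UniCircLym` is a `Prop`.
Its instance at `k = q + 1` summed over the circuits is exactly `(c)` (`uniLym_c_of_uniCircLym`).

* `circ`, `circ_subset`, `uniIndepSetsCirc`, `mem_uniIndepSetsCirc`;
* `card_uniIndepSets_eq_sum` (the fibre decomposition `U_k = Σ_D U^D_k`);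
* `UniCircLym` (the conjecture, a `def … : Prop`);
* **`uniLym_c_of_uniCircLym`** (`UniCircLym α → (c)` on every `M` with `#E = ρ + q + 1`, `q + 2 ≤ ρ`).
-/

open scoped Matroid

namespace PercRepro.Cogirth

open Finset ThmH Skew Shadow Profile

variable {α : Type} [DecidableEq α] {M : Matroid α} [M.Finite]

/-- The circuit-carrier of a finite set: the elements whose removal leaves an independent set.  For a unicyclic
set (`ρ(X) + 1 = #X`) this is its unique circuit. -/
noncomputable def circ (M : Matroid α) [M.Finite] (X : Finset α) : Finset α :=
  X.filter (fun x => rk M (X.erase x) = (X.erase x).card)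

/-- The circuit-carrier is a subset of the set. -/
theorem circ_subset (X : Finset α) : circ M X ⊆ X := filter_subset _ _

/-- Membership in `circ`. -/
theorem mem_circ {X : Finset α} {x : α} :
    x ∈ circ M X ↔ x ∈ X ∧ rk M (X.erase x) = (X.erase x).card := by
  unfold circ
  rw [mem_filter]

/-- The unicyclic `k`-sets with independent complement whose circuit-carrier is `D`. -/
noncomputable def uniIndepSetsCirc (M : Matroid α) [M.Finite] (D : Finset α) (k : ℕ) :
    Finset (Finset α) :=
  (uniIndepSets M k).filter (fun X => circ M X = D)

/-- Membership in `uniIndepSetsCirc`. -/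
theorem mem_uniIndepSetsCirc {D : Finset α} {k : ℕ} {X : Finset α} :
    X ∈ uniIndepSetsCirc M D k ↔ X ∈ uniIndepSets M k ∧ circ M X = D := by
  unfold uniIndepSetsCirc
  rw [mem_filter]

/-- **THE FIBRE DECOMPOSITION** `U_k = Σ_D U^D_k` over all subsets `D` of the ground set (the fibres of
non-circuits are empty). -/
theorem card_uniIndepSets_eq_sum (M : Matroid α) [M.Finite] (k : ℕ) :
    (uniIndepSets M k).card = ∑ D ∈ (gr M).powerset, (uniIndepSetsCirc M D k).card := by
  unfold uniIndepSetsCirc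
  apply card_eq_sum_card_fiberwise
  intro X hX
  rw [Finset.mem_coe, mem_powerset]
  exact (circ_subset X).trans (mem_uniIndepSets.1 hX).1

/-- **THE CIRCUIT-MARKED UNICYCLIC LYM CONJECTURE** (a `Prop`; NOT asserted): for every finite matroid on `n`
elements, every `D ⊆ E` and every `k` with `2k + 1 ≤ n`, `(n − k)·U^D_k ≤ k·U^D_{k+1}` — the density
`U^D_k / C(n−1, k−1)` of the unicyclic sets with circuit `D` and independent complement is nondecreasing up to the
middle.  `D = {e}` a loop: Theorem A (Brändén–Huh) for `M ∖ e`; `D` a parallel pair `{e, e'}`: the `e`-marked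
Theorem A for `M ∖ e'`, tight on uniform matroids.  DATA: 0 violations on every circuit of every matroid on `≤ 9`
elements (P10-AVFULL.md §19). -/
def UniCircLym (α : Type) [DecidableEq α] : Prop :=
  ∀ (M : Matroid α) [M.Finite] (D : Finset α) (k : ℕ), 2 * k + 1 ≤ (gr M).card →
    ((gr M).card - k) * (uniIndepSetsCirc M D k).card ≤ k * (uniIndepSetsCirc M D (k + 1)).card

/-- **THE BRIDGE**: the conjecture at `k = q + 1`, summed over the circuits, is the open piece `(c)` of the
top-but-one level on `#E = ρ + q + 1`: `ρ·U_{q+1} ≤ (q+1)·U_{q+2}`. -/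
theorem uniLym_c_of_uniCircLym (h : UniCircLym α) (M : Matroid α) [M.Finite] {q : ℕ}
    (hn : (gr M).card = rk M (gr M) + q + 1) (hq : q + 2 ≤ rk M (gr M)) :
    rk M (gr M) * (uniIndepSets M (q + 1)).card ≤ (q + 1) * (uniIndepSets M (q + 2)).card := by
  rw [card_uniIndepSets_eq_sum M (q + 1), card_uniIndepSets_eq_sum M (q + 2), mul_sum, mul_sum]
  apply sum_le_sum
  intro D _
  have h1 := h M D (q + 1) (by omega)
  have e : (gr M).card - (q + 1) = rk M (gr M) := by omega
  rw [e] at h1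
  exact h1

/-- The same bridge for the other half of the row: together with `(a′)` (`ρ·U_{ρ+1} ≤ (q+1)·(P_{ρ−1} + U_ρ)`,
taken as a hypothesis) the conjecture closes the top-but-one level `Π⁻_{q,ρ−1}` on `#E = ρ + q + 1`. -/
theorem profileIneqMinusQ_top_but_one_succ_of_uniCircLym (h : UniCircLym α) (M : Matroid α) [M.Finite]
    {q : ℕ} (hn : (gr M).card = rk M (gr M) + q + 1) (hq : q + 2 ≤ rk M (gr M))
    (ha : rk M (gr M) * (uniIndepSets M (rk M (gr M) + 1)).card ≤
      (q + 1) * ((biIndepSets M (rk M (gr M) - 1)).card + (uniIndepSets M (rk M (gr M))).card)) :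
    ProfileIneqMinusQ M q (rk M (gr M) - 1) := by
  rw [profileIneqMinusQ_iff_unicyclic hn hq]
  have hc := uniLym_c_of_uniCircLym h M hn hq
  nlinarith [ha, hc]

end PercRepro.Cogirth
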